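import Literature.AnabelianGeometry.SemiGraphs.CoverticialCoveringDoubleCosetProofs
import Literature.AnabelianGeometry.SemiGraphs.CoveringBranchFrames
import Literature.AnabelianGeometry.SemiGraphs.SurfaceTypeEstranged
import Literature.AnabelianGeometry.SemiGraphs.ProSigmaCompletionRestrict
import Literature.AnabelianGeometry.SemiGraphs.SurfaceTypeCoveringsToolkit
import Literature.AnabelianGeometry.Anabelioids.ExactFunctorProofs
import Literature.GroupTheory.CombinatorialGroupTheory.PuncturedSurfaceGroupFiniteIndex
import HarnessLib

/-!
# [SemiAnbd] Example 2.10 / Remark 2.4.1: surface type is stable under finite étale coverings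

Mochizuki, *Semi-graphs of anabelioids*, Publ. RIMS **42** (2006), Example 2.10 p. 31: a semi-graph
of anabelioids `𝒢` is *of surface type* (abc-iut-L3-t1's interface `IsOfSurfaceType`, `Coverticial.lean`)
if "each `Π_v` is the maximal pro-`Σ` quotient of the fundamental group of a hyperbolic Riemann surface
of finite type, and … each `Π_b → Π_v` is the inclusion morphism of the inertia group of one of the
cusps"; Remark 2.4.1 p. 26: the properties derived from it pass to finite étale coverings `𝒢' → 𝒢`
("one verifies easily …") [cite: MochizukiSemiAnbd2006, Ex. 2.10 p.31].  This file PROVES (abc-iut,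
layer L3, row W4-11, input of clause (3) "totally universally sub-coverticial" of `example_2_10`):

**`IsOfSurfaceType.of_isFiniteEtaleCoveringGlobal`** — if `𝒢` is of surface type for `Σ` and
`φ : 𝒢' → 𝒢` is a finite étale covering in print's sense (`Hom.IsFiniteEtaleCoveringGlobal`: local
description ∧ `B(𝒢') = B(𝒢)_{/A}` ∧ branch- ∧ vertex-aligned), then `𝒢'` is of surface type for `Σ`,
GRANTED the classical fact `PuncturedSurfaceGroupFiniteIndexSubgroup` (finite-index subgroups of
punctured surface groups are punctured surface groups WITH their peripheral structure — Riemann–Hurwitz;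
the punctured twin of the registered fact `SurfaceGroupFiniteIndexSubgroup`).

Proof (covering-space theory of the stable curve, done on fundamental groups).  At a vertex `v'`
over `v` with basepoint `F'`, put `G := φ_{v'}^* ⋙ F'` (a basepoint of `𝒢_v`) and
`ι := π₁(φ_{v'}) : Π_{v'} = Aut F' ↪ Π_v = Aut G`: injective with OPEN image `H` (the stabiliser of a
point of the fibre of the connected component `S ⊆ S_v` presenting `𝒢'_{v'}`, abc-iut-L6-t17's
dictionary).  The surface structure `ι₀ : Γ_{g,r} → Π_v` (dense, pro-`Σ` completion) restricts to a
pro-`Σ` completion `ι₀⁻¹(H) → H` (abc-iut-w5-d041's `IsProSigmaCompletion.restrict`), and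
`ι₀⁻¹(H) ≅ Γ_{g',r'}` by the classical fact, with cusps `j'` ↔ double cosets `ι₀⁻¹(H) γ ⟨c_j⟩`; transport
along `Aut F' ≅ H` gives `ι' : Γ_{g',r'} → Π_{v'}`.  For a branch `b'` at `v'` over `b` (cusp `j`), the
double-coset dictionary of the covering (abc-iut-L3-t1 / L4-t17: `covering_branchFibre_doubleCosets`)
says `ι(Π_{b'}) = H ∩ x Π̂_j x⁻¹` with `x` ranging over a double coset determined by `b'` and
`b' ↦ H x Π̂_j` injective; by density `x ∈ H ι₀(γ) Π̂_j` with `γ ∈ Γ_{g,r}`, and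
`H ∩ ι₀(γ) Π̂_j ι₀(γ)⁻¹ = cl ι₀(ι₀⁻¹H ∩ γ⟨c_j⟩γ⁻¹)` is, up to `H`-conjugacy (absorbed into the transport
`α'`), the closure of `ι'` of the standard cusp group `⟨c'_{j'}⟩` of the cusp `j'` over `(j, γ)`.
Distinct branches give distinct cusps (distinct double cosets, resp. distinct `j`).  Also: a covering of
a semi-graph of anabelioids of injective type is of injective type (`φ_{e'}` finite étale, the 2-cells).

HONEST FRAMING: a theorem about abc-iut-L3-t1's interface, conditional on ONE classical named fact;
nothing here takes a side on [IUTchIII] Cor. 3.12.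
-/

namespace Literature.AnabelianGeometry.SemiGraphs

open CategoryTheory CategoryTheory.PreGaloisCategory
open Literature.AnabelianGeometry.Anabelioids
open Literature.GroupTheory.CombinatorialGroupTheory
open scoped Pointwise
open Topology

universe v₁ u₁ u

namespace SemiGraphOfAnabelioids

variable {𝒢 𝒢' : SemiGraphOfAnabelioids.{v₁, u₁, u}}

/-! ### Continuity of `π₁(φ)` (local copy) -/

/-- `π₁(φ)` is continuous for the profinite topologies on automorphism groups of basepoints
(local copy of `continuous_pi1Map` of `CommensurabilityProofs4.lean`, to keep the imports light).
[folklore] -/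
private theorem continuous_pi1Map'' {X : Type*} [Category X] {Y : Type*} [Category Y]
    (P : Y ⥤ X) (F : X ⥤ FintypeCat.{v₁}) : Continuous (pi1Map P F) := by
  rw [(autEmbedding_isClosedEmbedding (P ⋙ F)).isInducing.continuous_iff, continuous_pi_iff]
  intro B
  have hco : (fun σ : Aut F => autEmbedding (P ⋙ F) (pi1Map P F σ) B) =
      fun σ => autEmbedding F σ (P.obj B) := by
    funext σ
    exact Iso.ext rfl
  change Continuous fun σ : Aut F => autEmbedding (P ⋙ F) (pi1Map P F σ) B
  rw [hco]
  exact (continuous_apply (P.obj B)).comp (autEmbedding_isClosedEmbedding F).continuous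

/-! ### A finite étale covering of a semi-graph of anabelioids of injective type is of injective type -/

/-- Along the finite étale covering attached to `A ∈ B(𝒢)`, the edge components `φ_{e'} : 𝒢'_{e'} → 𝒢_f`
are finite étale for EVERY presentation `f` of the image edge (transport of the edge clause of
`IsFiniteEtaleCoveringOf`). [cite: MochizukiSemiAnbd2006, Def. 2.2(i) p.23] -/
theorem isFiniteEtale_φE_of_isFiniteEtaleCoveringOf (φ : Hom 𝒢' 𝒢) (A : 𝒢.BObj)
    (hφ : φ.IsFiniteEtaleCoveringOf A) (e' : 𝒢'.graph.Edge) (f : 𝒢.graph.Edge)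
    (p : φ.base.edgeMap e' = f) : IsFiniteEtale (φ.φE e' f p).pullback := by
  subst p
  obtain ⟨-, cV, cE, -, -, -, hE, -⟩ := hφ
  obtain ⟨α, hα, hiso⟩ := hE e'
  exact ⟨_, α, hα, hiso⟩

/-- **Coverings of injective type.**  If `𝒢` is of injective type and `φ : 𝒢' → 𝒢` is the finite étale
covering attached to an object of `B(𝒢)`, then `𝒢'` is of injective type: `Π_{b'} → Π_{v'}` followed by
the injection `Π_{v'} ↪ Π_v` is, up to the 2-cell `φ_{b'}`, the composite of the injections
`Π_{e'} ↪ Π_e` (finite étale) and `Π_e ↪ Π_v`. [cite: MochizukiSemiAnbd2006, Rem. 2.4.1 p.26] -/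
theorem IsOfInjectiveType.of_isFiniteEtaleCoveringOf (hinj : 𝒢.IsOfInjectiveType) (φ : Hom 𝒢' 𝒢)
    (A : 𝒢.BObj) (hφ : φ.IsFiniteEtaleCoveringOf A) : 𝒢'.IsOfInjectiveType := by
  refine ⟨fun b' v' h' Fe' _ => ?_⟩
  set R := (φ.φE (𝒢'.graph.edgeOf b') (𝒢.graph.edgeOf (φ.base.branchMap b'))
      (φ.edgeMap_edgeOf_eq_of_branchMap_eq (φ.base.branchMap b') b' rfl)).pullback with hR
  haveI : FiberFunctor (R ⋙ Fe') := fiberFunctor_comp_of_exact _ _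
  have hE := isPi1Mono_of_isFiniteEtale
    (isFiniteEtale_φE_of_isFiniteEtaleCoveringOf φ A hφ (𝒢'.graph.edgeOf b')
      (𝒢.graph.edgeOf (φ.base.branchMap b')) (φ.edgeMap_edgeOf_eq_of_branchMap_eq _ b' rfl)) Fe'
  have hV := hinj.isPi1Mono (φ.base.branchMap b') (φ.base.vertexMap v')
    (φ.base.abuts_branchMap b' v' h') (R ⋙ Fe')
  intro σ₁ σ₂ hσ
  have key := fun σ => autMulEquivOfIso_alignIso_pi1Map φ b' v' h' (φ.base.branchMap b') rfl
    ((𝒢'.pull b' v' h').pullback ⋙ Fe') Fe' (Iso.refl _) σ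
  have h₁ := key σ₁
  have h₂ := key σ₂
  rw [hσ, ← h₂] at h₁
  exact hE (hV ((Aut.autMulEquivOfIso _).injective h₁))

/-! ### The main theorem -/

open PuncturedSurfaceGroup in
/-- **[SemiAnbd] Example 2.10 / Remark 2.4.1: a finite étale covering of a semi-graph of anabelioids of
surface type is of surface type**, granted the classical fact `PuncturedSurfaceGroupFiniteIndexSubgroup`
(finite-index subgroups of punctured surface groups, with peripheral structure).  See the module
docstring for the proof. [cite: MochizukiSemiAnbd2006, Ex. 2.10 p.31] -/
theorem IsOfSurfaceType.of_isFiniteEtaleCoveringGlobal (hA : PuncturedSurfaceGroupFiniteIndexSubgroup)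
    {Sigma : Set ℕ} (h𝒢 : 𝒢.IsOfSurfaceType Sigma) (φ : Hom 𝒢' 𝒢)
    (hφ : φ.IsFiniteEtaleCoveringGlobal) : 𝒢'.IsOfSurfaceType Sigma := by
  obtain ⟨A, hloc, -, hal, -⟩ := hφ
  refine ⟨h𝒢.sigma_primes, IsOfInjectiveType.of_isFiniteEtaleCoveringOf h𝒢.isOfInjectiveType φ A hloc,
    fun v' F' _ => ?_⟩
  classical
  -- the basepoint `G := φ_{v'}^* ⋙ F'` of `𝒢_v`
  set v := φ.base.vertexMap v' with hv
  set G : 𝒢.V v ⥤ FintypeCat.{v₁} := (φ.φV v').pullback ⋙ F' with hG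
  haveI : FiberFunctor G := fiberFunctor_comp_of_exact (φ.φV v').pullback F'
  -- the surface structure of `𝒢` at `(v, G)`
  obtain ⟨g, r, ι₀, hhyp, hι₀, js, hjs, hbr⟩ := h𝒢.vertex v G
  -- the local dictionary: `ι : Π_{v'} ↪ Π_v` with open image `H`
  obtain ⟨S, hS, αS, hαS, ⟨eS⟩⟩ := exists_iso_star_comp_φV φ A hloc v'
  haveI := hS
  haveI := hαS
  set ι : Aut F' →* Aut G :=
    (Aut.autMulEquivOfIso (Iso.refl G)).toMonoidHom.comp (pi1Map (φ.φV v').pullback F') with hιdef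
  have hrefl : ι = pi1Map (φ.φV v').pullback F' := by
    ext σ : 1
    refine Iso.ext ?_
    simp [hιdef, Aut.autMulEquivOfIso]
  have hιinj : Function.Injective ι := by
    rw [hrefl]; exact pi1Map_injective_of_star_comp αS eS F'
  have hιcont : Continuous ι := by
    rw [hrefl]; exact continuous_pi1Map'' _ _
  set H : Subgroup (Aut G) := ι.range with hHdef
  have hHopen : IsOpen (H : Set (Aut G)) := by
    obtain ⟨x⟩ := nonempty_fiber_of_isConnected ((φ.φV v').pullback ⋙ F') S
    let t : F'.obj (αS.obj (Over.mk (𝟙 S))) :=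
      F'.map (αS.map (Over.mkIdTerminal.from _)) (F'.map (eS.hom.app S) x)
    have h := range_pi1Map_eq_stabilizer αS eS F' (Iso.refl G) t
    rw [hHdef, hιdef, h]
    exact isOpen_stabilizer_fiber _ _ _
  -- `K := ι₀⁻¹(H)` has finite index; the classical fact
  set K : Subgroup (PuncturedSurfaceGroup g r) := H.comap ι₀ with hKdef
  haveI : K.FiniteIndex := IsProSigmaCompletion.finiteIndex_comap hι₀ H hHopen
  obtain ⟨g', r', θ, cusp, rep, hhyp', hθinj, hθrange, -, hθcusp, huniq⟩ := hA g r hhyp K inferInstance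
  have hmem : ∀ x, ι₀ (θ x) ∈ H := fun x => by
    have hx : θ x ∈ K := hθrange ▸ ⟨x, rfl⟩
    exact hx
  -- the pro-`Σ` completion `Γ_{g',r'} → H` and its transport to `Aut F'`
  have hcH : IsProSigmaCompletion Sigma ((ι₀.comp θ).codRestrict H hmem) :=
    IsProSigmaCompletion.restrict_comp_of_range_eq hι₀ H hHopen θ hθinj hθrange hmem
  let eι₀ : Aut F' ≃* H :=
    MulEquiv.ofBijective ι.rangeRestrict ⟨fun a b hab => hιinj (congrArg Subtype.val hab),
      ι.rangeRestrict_surjective⟩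
  have heι₀ : Continuous eι₀ := hιcont.subtype_mk _
  let eιₜ : Aut F' ≃ₜ H := Continuous.homeoOfEquivCompactToT2 (f := eι₀.toEquiv) heι₀
  let eι : Aut F' ≃ₜ* H :=
    { eι₀ with
      continuous_toFun := heι₀
      continuous_invFun := eιₜ.symm.continuous }
  let ι' : PuncturedSurfaceGroup g' r' →* Aut F' :=
    eι.symm.toMulEquiv.toMonoidHom.comp ((ι₀.comp θ).codRestrict H hmem)
  have hι' : IsProSigmaCompletion Sigma ι' := hcH.of_continuousMulEquiv_comp eι.symm
  have heιval : ∀ y : H, ι (eι.symm y) = (y : Aut G) := fun y => by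
    have h1 : ((eι (eι.symm y) : H) : Aut G) = (y : Aut G) := by rw [eι.apply_symm_apply]
    exact h1
  have hιι' : ∀ x, ι (ι' x) = ι₀ (θ x) := fun x => heιval _
  have hcomp : ι₀.comp θ = ι.comp ι' := MonoidHom.ext fun x => (hιι' x).symm
  have hιce : IsClosedEmbedding ι := hιcont.isClosedEmbedding hιinj
  -- reference data at the branches of `𝒢` at `v`: edge basepoints and SURFACE frames
  let B := {b : 𝒢.graph.Branch // 𝒢.graph.abuts b = some v}
  let Fe₀ : ∀ bb : B, 𝒢.E (𝒢.graph.edgeOf bb.1) ⥤ FintypeCat.{v₁} := fun bb =>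
    GaloisCategory.getFiberFunctor _
  have hα₀ : ∀ bb : B, ∃ α₀ : (𝒢.pull bb.1 v bb.2).pullback ⋙ Fe₀ bb ≅ G,
      𝒢.branchSubgroup G bb.1 bb.2 (Fe₀ bb) α₀ =
        ((cuspInertia (g := g) (js bb)).map ι₀).topologicalClosure := fun bb => by
    obtain ⟨α₀, h⟩ := hbr bb (Fe₀ bb)
    exact ⟨α₀, 𝒢.branchSubgroup_eq_topologicalClosure G bb.2 (Fe₀ bb) α₀ ι₀ _ h⟩
  choose α₀ hα₀ using hα₀
  -- the double-coset dictionary of the covering, per branch `bb` of `𝒢` at `v`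
  let Fib : B → Type u := fun bb =>
    {b' : 𝒢'.graph.Branch // φ.base.branchMap b' = bb.1 ∧ 𝒢'.graph.abuts b' = some v'}
  have hfact : ∀ bb : B, ∃ d : Fib bb → Aut G,
      Function.Injective (fun b' => DoubleCoset.mk H
        ((cuspInertia (g := g) (js bb)).map ι₀).topologicalClosure (d b')) ∧
      ∀ (b' : Fib bb) (Fe' : 𝒢'.E (𝒢'.graph.edgeOf b'.1) ⥤ FintypeCat.{v₁}) [FiberFunctor Fe']
        (α' : (𝒢'.pull b'.1 v' b'.2.2).pullback ⋙ Fe' ≅ F'),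
        ∃ x : Aut G, DoubleCoset.mk H ((cuspInertia (g := g) (js bb)).map ι₀).topologicalClosure x =
            DoubleCoset.mk H ((cuspInertia (g := g) (js bb)).map ι₀).topologicalClosure (d b') ∧
          (𝒢'.branchSubgroup F' b'.1 b'.2.2 Fe' α').map ι =
            H ⊓ ConjAct.toConjAct x • ((cuspInertia (g := g) (js bb)).map ι₀).topologicalClosure := by
    intro bb
    have h := covering_branchFibre_doubleCosets_holds 𝒢 𝒢' φ A hloc hal v' F' G (Iso.refl G)
      bb.1 bb.2 (Fe₀ bb) (α₀ bb)
    rw [hα₀ bb] at h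
    obtain ⟨d, hbij, hx⟩ := h
    exact ⟨d, hbij.1, hx⟩
  choose d hdinj hx using hfact
  -- notation for the branches of `𝒢'` at `v'`
  let B' := {b' : 𝒢'.graph.Branch // 𝒢'.graph.abuts b' = some v'}
  let bb : B' → B := fun b' => ⟨φ.base.branchMap b'.1, φ.base.abuts_branchMap b'.1 v' b'.2⟩
  let fib : ∀ b' : B', Fib (bb b') := fun b' => ⟨b'.1, rfl, b'.2⟩
  -- sheet representatives in `Γ_{g,r}` (density of `ι₀`) and the cusps upstairs
  have hγ : ∀ (x : B) (c : Fib x), ∃ γ : PuncturedSurfaceGroup g r, ι₀ γ * (d x c)⁻¹ ∈ H := by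
    intro x c
    have hopen : IsOpen ((fun y : Aut G => y * (d x c)⁻¹) ⁻¹' (H : Set (Aut G))) :=
      hHopen.preimage (continuous_id.mul continuous_const)
    obtain ⟨_, ⟨γ, rfl⟩, hγ⟩ := hι₀.dense.exists_mem_open hopen
      ⟨d x c, by simp only [Set.mem_preimage, mul_inv_cancel, SetLike.mem_coe]; exact H.one_mem⟩
    exact ⟨γ, hγ⟩
  choose γ hγ using hγ
  have hj : ∀ (x : B) (c : Fib x), ∃ j' : Fin r',
      (cusp j' = js x ∧ ∃ k ∈ K, ∃ z ∈ cuspInertia (g := g) (js x), rep j' = k * γ x c * z) ∧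
      ∀ j'' : Fin r', (cusp j'' = js x ∧ ∃ k ∈ K, ∃ z ∈ cuspInertia (g := g) (js x),
        rep j'' = k * γ x c * z) → j'' = j' := fun x c =>
    ⟨(huniq (js x) (γ x c)).choose, (huniq (js x) (γ x c)).choose_spec.1,
      fun j'' hj'' => (huniq (js x) (γ x c)).unique hj'' (huniq (js x) (γ x c)).choose_spec.1⟩
  choose js₂ hjs₂ hjs₂u using hj
  -- dependent congruence along equal base branches
  have hcongr : ∀ (x y : B) (exy : x = y) (c : Fib x) (c' : Fib y), c.1 = c'.1 →
      js₂ x c = js₂ y c' ∧ d x c = d y c' ∧ γ x c = γ y c' := by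
    rintro x _ rfl c c' hcc
    obtain rfl : c = c' := Subtype.ext hcc
    exact ⟨rfl, rfl, rfl⟩
  -- two fibre elements over the same branch with the same cusp upstairs coincide
  have hkey : ∀ (x : B) (c c' : Fib x), js₂ x c = js₂ x c' → c = c' := by
    intro x c c' hcc
    obtain ⟨⟨-, k, hk, z, hz, hrep⟩, ⟨-, k', hk', z', hz', hrep'⟩⟩ := And.intro (hjs₂ x c) (hjs₂ x c')
    rw [hcc] at hrep
    apply hdinj x
    -- `ι₀ γ'` lies in `H ι₀(γ) D̂`, hence the double cosets of `d x c`, `d x c'` agree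
    change DoubleCoset.mk H _ (d x c) = DoubleCoset.mk H _ (d x c')
    rw [DoubleCoset.eq]
    have e1 : γ x c' = k'⁻¹ * k * γ x c * (z * z'⁻¹) := by
      have := hrep'.symm.trans hrep
      -- k' γ' z' = k γ z
      calc γ x c' = k'⁻¹ * (k' * γ x c' * z') * z'⁻¹ := by group
        _ = k'⁻¹ * (k * γ x c * z) * z'⁻¹ := by rw [this]
        _ = k'⁻¹ * k * γ x c * (z * z'⁻¹) := by group
    refine ⟨(ι₀ (γ x c') * (d x c')⁻¹)⁻¹ * ι₀ (k'⁻¹ * k) * (ι₀ (γ x c) * (d x c)⁻¹),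
      H.mul_mem (H.mul_mem (H.inv_mem (hγ x c')) ?_) (hγ x c), ι₀ (z * z'⁻¹),
      Subgroup.le_topologicalClosure _ ⟨z * z'⁻¹, (cuspInertia _).mul_mem hz ((cuspInertia _).inv_mem hz'), rfl⟩, ?_⟩
    · exact K.mul_mem (K.inv_mem hk') hk
    · have e2 : ι₀ (γ x c') = ι₀ (k'⁻¹ * k) * ι₀ (γ x c) * ι₀ (z * z'⁻¹) := by
        rw [e1, map_mul, map_mul]
      calc d x c' = (ι₀ (γ x c') * (d x c')⁻¹)⁻¹ * ι₀ (γ x c') := by group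
        _ = (ι₀ (γ x c') * (d x c')⁻¹)⁻¹ * (ι₀ (k'⁻¹ * k) * ι₀ (γ x c) * ι₀ (z * z'⁻¹)) := by rw [← e2]
        _ = (ι₀ (γ x c') * (d x c')⁻¹)⁻¹ * ι₀ (k'⁻¹ * k) * (ι₀ (γ x c) * (d x c)⁻¹) * d x c *
              ι₀ (z * z'⁻¹) := by group
  refine ⟨g', r', ι', hhyp', hι', fun b' => js₂ (bb b') (fib b'), ?_, ?_⟩
  · -- injectivity of the cusp assignment
    intro b'₁ b'₂ heq
    have hc : js (bb b'₁) = js (bb b'₂) := by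
      rw [← (hjs₂ (bb b'₁) (fib b'₁)).1, ← (hjs₂ (bb b'₂) (fib b'₂)).1]
      exact congrArg cusp heq
    have hbb : bb b'₁ = bb b'₂ := hjs hc
    have p : φ.base.branchMap b'₂.1 = (bb b'₁).1 := by rw [hbb]
    have h2 := (hcongr (bb b'₂) (bb b'₁) hbb.symm (fib b'₂) ⟨b'₂.1, p, b'₂.2⟩ rfl).1
    have h3 := hkey (bb b'₁) (fib b'₁) ⟨b'₂.1, p, b'₂.2⟩ (heq.trans h2)
    exact Subtype.ext (congrArg (fun c : Fib (bb b'₁) => c.1) h3)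
  · -- the branch subgroups are closures of cusp inertia images
    intro b' Fe' _
    haveI : FiberFunctor ((𝒢'.pull b'.1 v' b'.2).pullback ⋙ Fe') := fiberFunctor_comp_of_exact _ _
    obtain ⟨α'₀⟩ := nonempty_iso_of_fiberFunctor ((𝒢'.pull b'.1 v' b'.2).pullback ⋙ Fe') F'
    set D := ((cuspInertia (g := g) (js (bb b'))).map ι₀).topologicalClosure with hDdef
    obtain ⟨x, hxd, hxB⟩ := hx (bb b') (fib b') Fe' α'₀
    obtain ⟨h₁, hh₁, p₁, hp₁, hxe⟩ := (DoubleCoset.eq _ _ _ _).mp hxd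
    -- `x • D = (w ι₀γ) • D` with `w ∈ H`
    set γ₀ := γ (bb b') (fib b') with hγ₀def
    have hu : ι₀ γ₀ * (d (bb b') (fib b'))⁻¹ ∈ H := hγ (bb b') (fib b')
    set w : Aut G := h₁⁻¹ * (ι₀ γ₀ * (d (bb b') (fib b'))⁻¹)⁻¹ with hwdef
    have hwH : w ∈ H := H.mul_mem (H.inv_mem hh₁) (H.inv_mem hu)
    have hx' : x = w * ι₀ γ₀ * p₁⁻¹ := by
      rw [hwdef]
      calc x = h₁⁻¹ * (h₁ * x * p₁) * p₁⁻¹ := by group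
        _ = h₁⁻¹ * d (bb b') (fib b') * p₁⁻¹ := by rw [← hxe]
        _ = h₁⁻¹ * (ι₀ γ₀ * (d (bb b') (fib b'))⁻¹)⁻¹ * ι₀ γ₀ * p₁⁻¹ := by group
    have hxD : ConjAct.toConjAct x • D = ConjAct.toConjAct (w * ι₀ γ₀) • D := by
      rw [hx', map_mul ConjAct.toConjAct (w * ι₀ γ₀), mul_smul,
        conjAct_smul_eq_self_of_mem (D.inv_mem hp₁)]
    -- `H ∩ (w ι₀γ₀) • D = w • (H ∩ ι₀γ₀ • D)` and `H ∩ ι₀γ₀ • D = cl ι₀(K ∩ γ₀⟨c_j⟩γ₀⁻¹)`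
    have h2 : H ⊓ ConjAct.toConjAct (w * ι₀ γ₀) • D =
        ConjAct.toConjAct w • (H ⊓ ConjAct.toConjAct (ι₀ γ₀) • D) := by
      rw [Subgroup.smul_inf, conjAct_smul_eq_self_of_mem hwH, map_mul, mul_smul]
    have h3 : H ⊓ ConjAct.toConjAct (ι₀ γ₀) • D =
        ((peripheralSubgroup K (js (bb b')) γ₀).map ι₀).topologicalClosure := by
      rw [hDdef, ← topologicalClosure_conjAct_smul, ← map_conjAct_smul, inf_comm,
        topologicalClosure_map_inf_of_isOpen ι₀ _ H hHopen, peripheralSubgroup,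
        map_conj_eq_conjAct_smul, inf_comm]
    -- the classical fact: `θ⟨c'_{j'}⟩ = k (K ∩ γ₀⟨c_j⟩γ₀⁻¹) k⁻¹`
    obtain ⟨hcusp, k, hk, z, hz, hrep⟩ := hjs₂ (bb b') (fib b')
    have hkH : ι₀ k ∈ H := hk
    have h4 : (cuspInertia (g := g') (js₂ (bb b') (fib b'))).map θ =
        ConjAct.toConjAct k • peripheralSubgroup K (js (bb b')) γ₀ := by
      rw [hθcusp, hcusp, hrep, peripheralSubgroup, peripheralSubgroup, map_conj_eq_conjAct_smul,
        map_conj_eq_conjAct_smul, hγ₀def, inf_conjAct_smul_mul_mul K _ hk hz]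
    -- assemble
    have h5a : (((cuspInertia (g := g') (js₂ (bb b') (fib b'))).map ι').topologicalClosure).map ι =
        (((cuspInertia (g := g') (js₂ (bb b') (fib b'))).map θ).map ι₀).topologicalClosure := by
      rw [← topologicalClosure_map_of_isClosedEmbedding ι hιce, Subgroup.map_map, ← hcomp,
        Subgroup.map_map]
    have h5 : (𝒢'.branchSubgroup F' b'.1 b'.2 Fe' α'₀).map ι =
        ConjAct.toConjAct (w * (ι₀ k)⁻¹) •
          (((cuspInertia (g := g') (js₂ (bb b') (fib b'))).map θ).map ι₀).topologicalClosure := by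
      rw [hxB, hxD, h2, h3, h4, map_conjAct_smul, topologicalClosure_conjAct_smul,
        map_mul ConjAct.toConjAct w (ι₀ k)⁻¹, mul_smul, map_inv, inv_smul_smul]
    obtain ⟨ω, hω⟩ : ∃ ω : Aut F', ι ω = w * (ι₀ k)⁻¹ := by
      have : w * (ι₀ k)⁻¹ ∈ H := H.mul_mem hwH (H.inv_mem hkH)
      rw [hHdef] at this
      exact this
    rw [← h5a, ← hω, ← map_conjAct_smul] at h5
    have h6 := Subgroup.map_injective hιinj h5
    -- the adjusted transport `α' := α'₀ ≫ ω⁻¹`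
    let ωi : F' ≅ F' := (ω⁻¹ : Aut F')
    refine ⟨α'₀ ≪≫ ωi, ?_⟩
    have ht : transportAut α'₀ (α'₀ ≪≫ ωi) = (ω⁻¹ : Aut F') := by
      simp [transportAut, ωi]
    rw [𝒢'.branchSubgroup_eq_conjAct_smul F' b'.1 b'.2 Fe' α'₀ (α'₀ ≪≫ ωi), ht, h6, ← mul_smul,
      ← map_mul, inv_mul_cancel, map_one, one_smul, Subgroup.topologicalClosure_coe, Subgroup.coe_map]

end SemiGraphOfAnabelioids

end Literature.AnabelianGeometry.SemiGraphs
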